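import Literature.MathematicalPhysics.QuantumLattice.PairStructureFactorFejerBox
import HarnessLib

/-!
# The Fejér box weight is bounded BELOW on a small-momentum window, and the reverse Fejér inequality
# `s_L(ψ) + T_ε(ψ)/(4L²) ≤ b_{L,n}(ψ)`

Topic `Literature/MathematicalPhysics/QuantumLattice` (namespace = path; family `hubbard`; cell `hubbard-cq`, seat p6,
companion of `PairStructureFactorFejerBox.lean` (F1)–(F3)). There the Fejér identity
`b_{L,n}(ψ) = L⁻² Σ_m F_n(m) S_ψ(m)` was used UPWARDS (`F_n ≤ 1`, decay of `F_n` outside a window) to bound the box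
average `b_{L,n}` by the torus diagonal `s_L` PLUS the window tail `T_ε/L²` PLUS a leakage. Here the SAME identity is
used DOWNWARDS: on a window `|q_m| ≤ ε` with `nε ≤ π/6` every Fejér weight is at least `1/4`, because the character
`χ_m(ū) = e^{iq_m·u}` has real part `cos(q_m·u) ≥ cos(π/3) = 1/2` for every `u ∈ [0,n)²`; dropping all other momenta by
positivity,

  `s_L(ψ) + T_ε(ψ)/(4L²)·… ≤ b_{L,n}(ψ)`, precisely `torusDiagonal g L ψ + windowTail g L ψ ε / 4 ≤ boxAvgPairCorr g L ψ n`.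

So a box average that does NOT exceed the torus diagonal by much FORCES a small window tail — the mechanism behind
«window tightness is automatic wherever the torus pair LRO attains its Koma–Tasaki value» (venture file
`Observables/TorusWindowTightness.lean`).

* `torusChar_proj_eq_exp_valMinAbs` / `torusChar_proj_re_eq_cos` — `χ_m(ū) = exp(i·(2π/L)Σᵢ m̃ᵢuᵢ)` with the centred
  representatives `m̃ᵢ = valMinAbs mᵢ`, `Re χ_m(ū) = cos(…)`;
* `abs_phase_le_of_momentumNormSq_le` — `|(2π/L)Σᵢ m̃ᵢuᵢ| ≤ 2nε` for `u ∈ [0,n)²`, `|q_m|² ≤ ε²`;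
* **`fejerBoxWeight_ge_quarter`** — `nε ≤ π/6`, `|q_m|² ≤ ε²`, `n ≥ 1` ⇒ `1/4 ≤ F_n(m)`;
* **`torusDiagonal_add_windowTail_div_four_le_boxAvgPairCorr`** — the reverse Fejér inequality above.

Pure finite-dimensional Fourier bookkeeping; nothing here concerns a Hamiltonian. Everything PROVED; no definition,
no named fact; zero compute.

## References
* L. Grafakos, *Classical Fourier Analysis* (2008), Prop. 3.1.7 (Fejér kernel; lower bound of the Dirichlet sum near the
  origin). [cite: Grafakos2008, Prop. 3.1.7]
* T. Kennedy, E. H. Lieb, B. S. Shastry, Phys. Rev. Lett. 61 (1988) 2582 (structure factor, small-momentum window).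
  [cite: KLS1988PRL, p. 2583]
-/

noncomputable section

namespace Literature.MathematicalPhysics.QuantumLattice

open Matrix Finset Literature.Probability.LatticeModels HubbardWave0
open scoped ComplexOrder ComplexConjugate

section Window

variable (L : ℕ) [NeZero L]

/-! ### Characters at lattice points, with centred representatives -/

/-- `χ_m(ū) = exp(i·(2π/L)·Σᵢ valMinAbs(mᵢ)·uᵢ)` for a lattice point `u ∈ ℤ²` (the character only depends on
`mᵢuᵢ mod L`, so any integer representative of `mᵢ` may be used; we use the one of least absolute value).
[cite: Grafakos2008, Prop. 3.1.7] -/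
theorem torusChar_proj_eq_exp_valMinAbs (m : TorusSite 2 L) (u : Site 2) :
    torusChar m (Torus.proj L u) =
      Complex.exp (((2 * Real.pi / (L : ℝ) * ∑ i, ((m i).valMinAbs : ℝ) * (u i : ℝ) : ℝ) : ℂ) * Complex.I) := by
  unfold torusChar
  have e : ∀ i : Fin 2, m i * Torus.proj L u i = (((m i).valMinAbs * u i : ℤ) : ZMod L) := by
    intro i
    rw [Int.cast_mul, ZMod.coe_valMinAbs]
    rfl
  simp_rw [e, ZMod.stdAddChar_coe, ← Complex.exp_sum]
  congr 1
  push_cast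
  rw [Finset.mul_sum, Finset.sum_mul]
  refine Finset.sum_congr rfl fun i _ => ?_
  ring

/-- `Re χ_m(ū) = cos((2π/L)·Σᵢ valMinAbs(mᵢ)·uᵢ)`. [cite: Grafakos2008, Prop. 3.1.7] -/
theorem torusChar_proj_re_eq_cos (m : TorusSite 2 L) (u : Site 2) :
    (torusChar m (Torus.proj L u)).re =
      Real.cos (2 * Real.pi / (L : ℝ) * ∑ i, ((m i).valMinAbs : ℝ) * (u i : ℝ)) := by
  rw [torusChar_proj_eq_exp_valMinAbs, Complex.exp_ofReal_mul_I_re]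

omit [NeZero L] in
/-- Each centred momentum component is bounded by the window radius: `|q_m|² ≤ ε²`, `ε ≥ 0` ⇒
`|2π·valMinAbs(mᵢ)/L| ≤ ε`. [cite: KLS1988PRL, p. 2583] -/
theorem abs_momentum_component_le {m : TorusSite 2 L} {ε : ℝ} (hε : 0 ≤ ε) (hm : momentumNormSq L m ≤ ε ^ 2)
    (i : Fin 2) : |2 * Real.pi / (L : ℝ) * ((m i).valMinAbs : ℝ)| ≤ ε := by
  refine abs_le_of_sq_le_sq ?_ hε
  rw [momentumNormSq_apply] at hm
  have hle : (((m i).valMinAbs : ℤ) : ℝ) ^ 2 ≤ ∑ j, (((m j).valMinAbs : ℤ) : ℝ) ^ 2 :=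
    Finset.single_le_sum (f := fun j => (((m j).valMinAbs : ℤ) : ℝ) ^ 2) (fun j _ => sq_nonneg _) (mem_univ i)
  calc (2 * Real.pi / (L : ℝ) * ((m i).valMinAbs : ℝ)) ^ 2
      = (2 * Real.pi / (L : ℝ)) ^ 2 * (((m i).valMinAbs : ℤ) : ℝ) ^ 2 := by rw [mul_pow]
    _ ≤ (2 * Real.pi / (L : ℝ)) ^ 2 * ∑ j, (((m j).valMinAbs : ℤ) : ℝ) ^ 2 :=
        mul_le_mul_of_nonneg_left hle (sq_nonneg _)
    _ ≤ ε ^ 2 := hm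

omit [NeZero L] in
/-- **Phase bound on the box**: for `u ∈ [0,n)²` and `|q_m|² ≤ ε²` (`ε ≥ 0`),
`|(2π/L)·Σᵢ valMinAbs(mᵢ)·uᵢ| ≤ 2nε`. [cite: Grafakos2008, Prop. 3.1.7] -/
theorem abs_phase_le_of_momentumNormSq_le {m : TorusSite 2 L} {ε : ℝ} (hε : 0 ≤ ε)
    (hm : momentumNormSq L m ≤ ε ^ 2) {n : ℕ} {u : Site 2} (hu : u ∈ halfOpenBox 2 n) :
    |2 * Real.pi / (L : ℝ) * ∑ i, ((m i).valMinAbs : ℝ) * (u i : ℝ)| ≤ 2 * (n : ℝ) * ε := by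
  rw [mem_halfOpenBox] at hu
  rw [Finset.mul_sum]
  refine (Finset.abs_sum_le_sum_abs _ _).trans ?_
  have hterm : ∀ i : Fin 2, |2 * Real.pi / (L : ℝ) * (((m i).valMinAbs : ℝ) * (u i : ℝ))| ≤ (n : ℝ) * ε := by
    intro i
    obtain ⟨h0, hlt⟩ := hu i
    have hui : |(u i : ℝ)| ≤ (n : ℝ) := by
      rw [abs_of_nonneg (by exact_mod_cast h0)]
      exact_mod_cast hlt.le
    rw [← mul_assoc, abs_mul]
    calc |2 * Real.pi / (L : ℝ) * ((m i).valMinAbs : ℝ)| * |(u i : ℝ)|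
        ≤ ε * (n : ℝ) := mul_le_mul (abs_momentum_component_le L hε hm i) hui (abs_nonneg _) hε
      _ = (n : ℝ) * ε := mul_comm _ _
  calc ∑ i : Fin 2, |2 * Real.pi / (L : ℝ) * (((m i).valMinAbs : ℝ) * (u i : ℝ))|
      ≤ ∑ _i : Fin 2, (n : ℝ) * ε := Finset.sum_le_sum fun i _ => hterm i
    _ = 2 * (n : ℝ) * ε := by simp [Finset.sum_const]; ring

/-! ### The Fejér weight on the window -/

/-- **On the window the character's real part is at least `1/2` throughout the box**: `nε ≤ π/6`, `|q_m|² ≤ ε²`,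
`u ∈ [0,n)²` ⇒ `1/2 ≤ Re χ_m(ū)` (`cos θ ≥ cos(π/3)` for `|θ| ≤ π/3`). [cite: Grafakos2008, Prop. 3.1.7] -/
theorem half_le_torusChar_proj_re {m : TorusSite 2 L} {ε : ℝ} (hε : 0 ≤ ε) (hm : momentumNormSq L m ≤ ε ^ 2)
    {n : ℕ} (hnε : (n : ℝ) * ε ≤ Real.pi / 6) {u : Site 2} (hu : u ∈ halfOpenBox 2 n) :
    1 / 2 ≤ (torusChar m (Torus.proj L u)).re := by
  rw [torusChar_proj_re_eq_cos]
  set θ : ℝ := 2 * Real.pi / (L : ℝ) * ∑ i, ((m i).valMinAbs : ℝ) * (u i : ℝ) with hθ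
  have hθle : |θ| ≤ Real.pi / 3 := by
    have := abs_phase_le_of_momentumNormSq_le L hε hm hu
    rw [← hθ] at this
    linarith
  rw [← Real.cos_abs θ, ← Real.cos_pi_div_three]
  exact Real.cos_le_cos_of_nonneg_of_le_pi (abs_nonneg θ) (by linarith [Real.pi_pos]) hθle

/-- **THE FEJÉR WEIGHT IS AT LEAST `1/4` ON THE WINDOW**: for `n ≥ 1`, `|q_m|² ≤ ε²` and `nε ≤ π/6`,
`1/4 ≤ F_n(m) = n⁻⁴|Σ_{u∈[0,n)²} χ_m(ū)|²` (the modulus of the box sum is at least its real part `≥ n²/2`).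
[cite: Grafakos2008, Prop. 3.1.7] -/
theorem fejerBoxWeight_ge_quarter {m : TorusSite 2 L} {ε : ℝ} (hε : 0 ≤ ε) (hm : momentumNormSq L m ≤ ε ^ 2)
    {n : ℕ} (hn : n ≠ 0) (hnε : (n : ℝ) * ε ≤ Real.pi / 6) :
    1 / 4 ≤ fejerBoxWeight L n m := by
  unfold fejerBoxWeight
  have hn0 : (0 : ℝ) < (n : ℝ) := by exact_mod_cast Nat.pos_of_ne_zero hn
  have hn4 : (0 : ℝ) < (n : ℝ) ^ 4 := by positivity
  -- the real part of the box sum is at least `n²/2`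
  have hre : (n : ℝ) ^ 2 / 2 ≤ (∑ u ∈ halfOpenBox 2 n, torusChar m (Torus.proj L u)).re := by
    rw [Complex.re_sum]
    calc (n : ℝ) ^ 2 / 2 = ∑ _u ∈ halfOpenBox 2 n, (1 / 2 : ℝ) := by
          rw [Finset.sum_const, card_halfOpenBox, nsmul_eq_mul]
          push_cast
          ring
      _ ≤ ∑ u ∈ halfOpenBox 2 n, (torusChar m (Torus.proj L u)).re :=
          Finset.sum_le_sum fun u hu => half_le_torusChar_proj_re L hε hm hnε hu
  have hnorm : (n : ℝ) ^ 2 / 2 ≤ ‖∑ u ∈ halfOpenBox 2 n, torusChar m (Torus.proj L u)‖ :=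
    hre.trans (Complex.re_le_norm _)
  have hsq : ((n : ℝ) ^ 2 / 2) ^ 2 ≤ ‖∑ u ∈ halfOpenBox 2 n, torusChar m (Torus.proj L u)‖ ^ 2 :=
    pow_le_pow_left₀ (by positivity) hnorm 2
  rw [le_div_iff₀ hn4]
  calc 1 / 4 * (n : ℝ) ^ 4 = ((n : ℝ) ^ 2 / 2) ^ 2 := by ring
    _ ≤ _ := hsq

/-! ### The reverse Fejér inequality -/

variable (g : Site 2 → ℝ)

/-- **REVERSE FEJÉR INEQUALITY**: for every torus vector `ψ`, `n ≥ 1`, `ε ≥ 0` with `nε ≤ π/6`,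
`s_L(ψ) + T_ε(ψ)/(4·L²)·L² = torusDiagonal g L ψ + windowTail g L ψ ε / 4 ≤ boxAvgPairCorr g L ψ n` — in the Fejér
identity (F1) keep the zero mode (weight `1`) and the window modes (weights `≥ 1/4`), drop all other modes by
positivity. Consequently a box average within `δ` of the torus diagonal forces `T_ε(ψ)/L² ≤ 4δ`.
[cite: Grafakos2008, Prop. 3.1.7] [cite: KLS1988PRL, p. 2583] -/
theorem torusDiagonal_add_windowTail_div_four_le_boxAvgPairCorr (ψ : Fock (Orb (FermionTorus 2 L))) {n : ℕ}
    (hn : n ≠ 0) {ε : ℝ} (hε : 0 ≤ ε) (hnε : (n : ℝ) * ε ≤ Real.pi / 6) :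
    torusDiagonal g L ψ + windowTail g L ψ ε / 4 ≤ boxAvgPairCorr g L ψ n := by
  have hL2 : (0 : ℝ) < (L : ℝ) ^ 2 := by
    have : (0 : ℝ) < (L : ℝ) := by exact_mod_cast Nat.pos_of_ne_zero (NeZero.ne L)
    positivity
  set W : Finset (TorusSite 2 L) := univ.filter (fun m : TorusSite 2 L => m ≠ 0 ∧ momentumNormSq L m ≤ ε ^ 2)
    with hW
  -- numerator inequality: `S(0) + (Σ_W S)/4 ≤ Σ_m F_n(m) S(m)`
  have key : pairStructureFactor g L ψ 0 + (∑ m ∈ W, pairStructureFactor g L ψ m) / 4 ≤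
      ∑ m, fejerBoxWeight L n m * pairStructureFactor g L ψ m := by
    have h0W : (0 : TorusSite 2 L) ∉ W := by
      rw [hW, mem_filter]
      exact fun h => h.2.1 rfl
    have hsub : insert (0 : TorusSite 2 L) W ⊆ univ := subset_univ _
    have h1 : ∑ m ∈ insert (0 : TorusSite 2 L) W, fejerBoxWeight L n m * pairStructureFactor g L ψ m ≤
        ∑ m, fejerBoxWeight L n m * pairStructureFactor g L ψ m :=
      sum_le_sum_of_subset_of_nonneg hsub fun m _ _ =>
        mul_nonneg (fejerBoxWeight_nonneg L n m) (pairStructureFactor_nonneg g L ψ m)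
    rw [sum_insert h0W, fejerBoxWeight_zero L hn, one_mul] at h1
    have h2 : (∑ m ∈ W, pairStructureFactor g L ψ m) / 4 ≤
        ∑ m ∈ W, fejerBoxWeight L n m * pairStructureFactor g L ψ m := by
      rw [div_eq_mul_one_div, sum_mul]
      refine sum_le_sum fun m hm => ?_
      rw [hW, mem_filter] at hm
      rw [mul_comm]
      exact mul_le_mul_of_nonneg_right (fejerBoxWeight_ge_quarter L hε hm.2.2 hn hnε)
        (pairStructureFactor_nonneg g L ψ m)
    linarith
  calc torusDiagonal g L ψ + windowTail g L ψ ε / 4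
      = (pairStructureFactor g L ψ 0 + (∑ m ∈ W, pairStructureFactor g L ψ m) / 4) / (L : ℝ) ^ 2 := by
        rw [torusDiagonal, windowTail, hW]
        ring
    _ ≤ (∑ m, fejerBoxWeight L n m * pairStructureFactor g L ψ m) / (L : ℝ) ^ 2 :=
        div_le_div_of_nonneg_right key hL2.le
    _ = boxAvgPairCorr g L ψ n := (boxAvgPairCorr_eq_sum_fejerBoxWeight_mul g L ψ hn).symm

end Window

end Literature.MathematicalPhysics.QuantumLattice
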